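import Literature.Probability.RandomPlanarGeometry.ChordalKSCondition
import Literature.Probability.RandomPlanarGeometry.SLE
import HarnessLib

/-!
# Chordal SLE_κ (κ < 8) satisfies the Kemppainen–Smirnov condition G2 (named fact)

Topic `Literature/Probability/RandomPlanarGeometry`. A NAMED FACT (`def … : Prop`, not proved here):
for `κ < 8`, every family `Q` of chordal SLE_κ laws on Dobrushin domains satisfies Kemppainen–Smirnov's
Condition G2 — the geometric bound on an unforced crossing — with ONE constant for all Dobrushin
domains, all first-hitting-time pasts and all scales, i.e. `∃ C, Q.SatisfiesKSCondition C`
(`ChordalKSCondition.lean`).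

## Source and what is printed

A. Kemppainen, S. Smirnov, *Random curves, scaling limits and Loewner evolutions*, Ann. Probab. 45
(2017) 698–779, arXiv:1212.6215. In §1.3, proof of the continuity-in-`κ` theorem (Thm. 1.7 of the
arXiv text; Thm. 1.10-type statement "SLE_κ is continuous in κ on [0, 8)"), first paragraph: "First we
verify that the family consisting of SLE(κ)s on `𝔻`, say, where `κ` runs over the interval
`[0, κ₀]`, satisfies Condition G2. Since SLE_κ has the conformal domain Markov property, it is enough
to verify Condition C1' in `ℍ` … [the probability that SLE_κ in `ℍ` intersects `B̄(1, ρ)` is less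
than `1/2` for small `ρ`] by standard arguments [Rohde–Schramm 2005]" (`κ₀ < 8`). Together with the
conformal invariance of Condition G2 with a constant depending only on the original constant
(Prop. 2.6 and Remark 2.8 of the journal numbering; arXiv Prop. 2.5 / Remark 2.7), this carries the
bound from `𝔻` to every simply connected domain, hence to the Kemppainen–Smirnov collection
`Σ_Q = {(D, a, b, Q D)}` of a family of chordal SLE_κ laws on Dobrushin domains (each `Q D` is the
conformal image of `Q 𝔻`: `ChordalFamily.isConformallyCovariant_of_isSLELaw`, `IsSLELaw.unique'`).

## Faithfulness notes

* Printed uniformly over `κ ∈ [0, κ₀]`, `κ₀ < 8`; stated here for one `κ < 8` at a time (weaker).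
* The tree's `SatisfiesKSCondition` is the integrated, `≤ 1/2`, first-hitting-time form of G2 for the
  collection of ALL Dobrushin domains (see the faithfulness notes of `ChordalKSCondition.lean`); the
  printed G2 (all stopping times, strict inequality, arbitrary collection) implies it.
* The printed proof is a sketch; a sorry-free proof in the tree's vocabulary needs the geometric half
  of KS Prop. 2.6 (C3 ⇒ G2: Beurling's extremal-length bound for the quadrilaterals cut from `U_τ` by
  arcs of concentric circles and the separating-arc induction of §2.2), the symmetrisation /
  Teichmüller extremal-problem step (Ahlfors, *Conformal invariants*, Thm. 4-7) for avoidable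
  quadrilaterals of `ℍ`, and a disintegration of past-dependent future events through the SLE Markov
  kernel (`sleMarkovKernel`). The probabilistic inputs exist in the tree
  (`measure_infDist_ofReal_sleTrace_le`, `exists_const_measureReal_hitAfter_le`,
  `halfPlane_extremalDistance_log_bounds_holds`, `ChordalFamily.isDomainMarkov_of_isSLELaw`).
* Consumer: stub `stub_sleSixKS` of crux `CardyShadowIsolated` (stmt-CriticalPhenomena-5767), which is
  this fact at `κ = 6`.
-/

noncomputable section

open MeasureTheory
open scoped NNReal

namespace Literature.Probability.RandomPlanarGeometry

/-- **Chordal SLE_κ, `κ < 8`, satisfies Kemppainen–Smirnov's Condition G2 with one constant for all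
Dobrushin domains** (named fact). For every `κ < 8` and every family `Q` of chordal SLE_κ laws
(`IsSLELaw κ D (Q D)` for every Dobrushin domain `D`) there is `C` with `Q.SatisfiesKSCondition C`:
`1 < C` and for every `D`, every first hitting time `τ_F` of a nonempty closed `F`, every annulus
`A(z₀, r, R)` with `0 < r`, `C r ≤ R` and every measurable set `S` of pasts,
`Q D ({γ[0,τ_F] ∈ S} ∩ {γ[τ_F,1] crosses A inside A^u_{τ_F}}) ≤ ½ · Q D {γ[0,τ_F] ∈ S}`. Printed:
"the family consisting of SLE(κ)s on 𝔻, κ ∈ [0, κ₀], satisfies Condition G2" (κ₀ < 8; conformal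
domain Markov property + the time-zero conformal condition in ℍ + Rohde–Schramm estimates), with the
conformal invariance of G2 (Prop. 2.6, Remark 2.8) transporting the constant to every simply connected
domain. [cite: KemppainenSmirnov2017, §1.3 (proof of the continuity of SLE in κ, arXiv:1212.6215 Thm 1.7) with Prop. 2.6 and Remark 2.8] -/
def exists_satisfiesKSCondition_of_isSLELaw : Prop :=
  ∀ {κ : ℝ≥0}, κ < 8 → ∀ {Q : ChordalFamily},
    (∀ D : DobrushinDomain, IsSLELaw κ D (Q D)) → ∃ C : ℝ, Q.SatisfiesKSCondition C

/-- Specialisation to `κ = 6`: under the named fact, every family of chordal SLE₆ laws satisfies the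
KS condition with some constant (the form consumed by crux `CardyShadowIsolated`).
[cite: KemppainenSmirnov2017, §1.3] -/
theorem exists_satisfiesKSCondition_of_isSLELaw_six (h : exists_satisfiesKSCondition_of_isSLELaw)
    {Q : ChordalFamily} (hQ : ∀ D : DobrushinDomain, IsSLELaw 6 D (Q D)) :
    ∃ C : ℝ, Q.SatisfiesKSCondition C :=
  h (by norm_num) hQ

end Literature.Probability.RandomPlanarGeometry

end
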